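import Literature.Geometry.Lorentzian.TameGenericityLocalWindow
import Literature.Geometry.Lorentzian.DataFamilyTangentKernelManifold
import HarnessLib

/-!
# Tame genericity: window control suffices for CURVES immersed at the base point — injectivity on
# a window comes for free

`TameGenericityLocalWindow.lean` reparametrises a tame, immersed family which is injective,
admissible and good ON A WINDOW `‖c‖ < ε` into a global witness family
(`InitialDataSet.exists_tameFamily_of_localWindow`). For ONE-parameter families (`m = 1`, the case
of the final-state summit) the window injectivity hypothesis is automatic: a curve immersed at `0`
(`InitialDataSet.IsImmersedAtZero 1 F`: some scalar component `c ↦ h_c(x)(u, w)` or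
`c ↦ k_c(x)(u, w)` has non-zero derivative at `c = 0`) is injective on a small window, because the
components of a jointly smooth family are `C^∞` in the parameter and a `C¹` real function with
non-zero derivative at `0` is strictly monotone near `0`.

* `InitialDataSet.contDiffAt_bilin_line` — the fibre-by-fibre curves `s ↦ σ_{s e₀}(x)` of a jointly
  smooth one-parameter family of bilinear-form sections are `C^∞` (the `C^∞` form of
  `differentiableAt_bilin_line`, same proof: read the section at the fixed base point through the
  trivialisation there and undo it);
* `InitialDataSet.contDiff_h_inner_line`, `contDiff_k_line` — hence `s ↦ h_{s e₀}(x)(u, w)` and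
  `s ↦ k_{s e₀}(x)(u, w)` are `C^∞` real functions for a smooth family of data
  (`IsSmoothDataFamily 1 F`);
* `exists_injOn_Ioo_of_deriv_ne_zero` — a `C¹` function `g : ℝ → ℝ` with `g'(0) ≠ 0` is injective on
  some `(−δ, δ)`;
* `InitialDataSet.exists_window_injective_of_isImmersedAtZero` — **a smooth curve of data immersed at
  `0` is injective on a window** `‖c‖ < δ`;
* `InitialDataSet.exists_tameCurve_of_localWindow` — **window control suffices for curves**: tame +
  immersed at `0` + (admissible, `P` off `0`) on a window ⇒ a tame, injective, immersed curve through
  the same base datum on the same end, admissible, with `P` off `0`;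
  `InitialDataSet.exists_tameCurve_of_window` — the same with no admissibility clause (the shape of
  the stub `stub_windowUpgrade` of line `base_point_reduction` of crux `CensorshipAlongKerrEnds`,
  route ExactKerrEnds of the final-state summit);
* `InitialDataSet.hasTameCodimAtLeastIn_one_of_localWindow`,
  `InitialDataSet.isTameChristodoulouGeneric_one_of_localWindow` — the genericity forms for curves: the
  `m = 1` case of `hasTameCodimAtLeastIn_of_localWindow` / `isTameChristodoulouGeneric_of_localWindow`
  with the window-injectivity hypothesis dropped (the weakest witness form a curve construction on the
  final-state summit has to deliver).

Christodoulou, CQG **16** (1999) A23, p. A24 (genericity through one-parameter families in a fixed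
space of data). Folklore bookkeeping; nothing analytic; no definitions, no named facts.
-/

noncomputable section

set_option maxSynthPendingDepth 3

open Bundle Set Function Filter TopologicalSpace Manifold Module
open scoped Manifold ContDiff Topology

namespace Literature.Geometry.Lorentzian

/-! ### A `C¹` real function with non-zero derivative at `0` is injective near `0` -/

/-- **Local injectivity from a non-zero derivative**: if `g : ℝ → ℝ` is `C¹` and `g'(0) ≠ 0`,
then `g` is injective on some interval `(−δ, δ)`, `δ > 0` (the derivative keeps its sign on a
neighbourhood of `0`, by continuity, so `g` is strictly monotone there). [folklore] -/
theorem exists_injOn_Ioo_of_deriv_ne_zero {g : ℝ → ℝ} (hg : ContDiff ℝ 1 g) (h0 : deriv g 0 ≠ 0) :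
    ∃ δ > 0, InjOn g (Ioo (-δ) δ) := by
  have hcont : Continuous (deriv g) := hg.continuous_deriv le_rfl
  have hgc : Continuous g := hg.continuous
  -- the derivative keeps its sign on a ball around `0`
  have hsign : ∀ᶠ s in 𝓝 (0 : ℝ), deriv g s ≠ 0 ∧ (0 < deriv g s ↔ 0 < deriv g 0) := by
    rcases lt_or_gt_of_ne h0 with hneg | hpos
    · have hev : ∀ᶠ s in 𝓝 (0 : ℝ), deriv g s < 0 :=
        hcont.continuousAt.eventually (gt_mem_nhds hneg)
      exact hev.mono fun s hs ↦ ⟨hs.ne, ⟨fun h ↦ absurd hs (not_lt.2 h.le), fun h ↦ absurd hneg (not_lt.2 h.le)⟩⟩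
    · have hev : ∀ᶠ s in 𝓝 (0 : ℝ), 0 < deriv g s :=
        hcont.continuousAt.eventually (lt_mem_nhds hpos)
      exact hev.mono fun s hs ↦ ⟨hs.ne', ⟨fun _ ↦ hpos, fun _ ↦ hs⟩⟩
  obtain ⟨δ, hδ, hball⟩ := Metric.eventually_nhds_iff.1 hsign
  refine ⟨δ, hδ, ?_⟩
  have hIoo : ∀ s ∈ Ioo (-δ) δ, dist s (0 : ℝ) < δ := fun s hs ↦ by
    rw [Real.dist_eq, sub_zero]
    exact abs_lt.2 hs
  rcases lt_or_gt_of_ne h0 with hneg | hpos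
  · -- strictly antitone on the window
    have hanti : StrictAntiOn g (Ioo (-δ) δ) :=
      strictAntiOn_of_deriv_neg (convex_Ioo _ _) hgc.continuousOn fun s hs ↦ by
        rw [interior_Ioo] at hs
        obtain ⟨hne, hiff⟩ := hball (hIoo s hs)
        have : ¬ 0 < deriv g s := fun h ↦ absurd (hiff.1 h) (not_lt.2 hneg.le)
        exact lt_of_le_of_ne (not_lt.1 this) hne
    exact hanti.injOn
  · have hmono : StrictMonoOn g (Ioo (-δ) δ) :=
      strictMonoOn_of_deriv_pos (convex_Ioo _ _) hgc.continuousOn fun s hs ↦ by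
        rw [interior_Ioo] at hs
        exact (hball (hIoo s hs)).2.2 hpos
    exact hmono.injOn

namespace InitialDataSet

variable {X : Type*} [TopologicalSpace X] [ChartedSpace E3 X] [IsManifold (𝓡 3) ∞ X]

/-! ### The fibre-by-fibre curves of a smooth family are smooth in the parameter -/

/-- **A jointly smooth one-parameter family of bilinear-form sections is `C^∞` in the parameter,
fibre by fibre**: for `x : X`, the curve `s ↦ σ_{s e₀}(x)` of forms on `T_x X = E3` is `C^∞`
(read the section at the fixed base point `x` through the trivialisation at `x`,
`contMDiffAt_bilin_iff`, and undo the — invertible — trivialisation; the `C^∞` form of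
`differentiableAt_bilin_line`). [folklore] -/
theorem contDiffAt_bilin_line
    {σ : EuclideanSpace ℝ (Fin 1) → Π x : X, TangentSpace (𝓡 3) x →L[ℝ] TangentSpace (𝓡 3) x →L[ℝ] ℝ}
    (hσ : ContMDiff (𝓘(ℝ, EuclideanSpace ℝ (Fin 1)).prod (𝓡 3)) ((𝓡 3).prod 𝓘(ℝ, E3 →L[ℝ] E3 →L[ℝ] ℝ)) ∞
      (fun p : EuclideanSpace ℝ (Fin 1) × X ↦ TotalSpace.mk' (E3 →L[ℝ] E3 →L[ℝ] ℝ)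
        (E := fun x : X ↦ TangentSpace (𝓡 3) x →L[ℝ] TangentSpace (𝓡 3) x →L[ℝ] ℝ) p.2 (σ p.1 p.2)))
    (x : X) (t : ℝ) :
    ContDiffAt ℝ ∞ (fun s : ℝ ↦ (show E3 →L[ℝ] E3 →L[ℝ] ℝ from σ (EuclideanSpace.single 0 s) x)) t := by
  -- the section along the axis at the fixed base point `x`
  have h0 : ContMDiffAt 𝓘(ℝ, ℝ) ((𝓡 3).prod 𝓘(ℝ, E3 →L[ℝ] E3 →L[ℝ] ℝ)) ∞
      (fun s : ℝ ↦ TotalSpace.mk' (E3 →L[ℝ] E3 →L[ℝ] ℝ)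
        (E := fun x : X ↦ TangentSpace (𝓡 3) x →L[ℝ] TangentSpace (𝓡 3) x →L[ℝ] ℝ) x
        (σ (EuclideanSpace.single 0 s) x)) t :=
    (hσ _).comp t (contDiff_single_zero.contMDiff.contMDiffAt.prodMk contMDiffAt_const)
  set τ := trivializationAt E3 (TangentSpace (𝓡 3) : X → Type _) x with hτ
  have hx : x ∈ τ.baseSet := FiberBundle.mem_baseSet_trivializationAt' x
  have h1 := ((contMDiffAt_bilin_iff (IX := 𝓘(ℝ, ℝ)) (IB := 𝓡 3)
    (V := (TangentSpace (𝓡 3) : X → Type _)) (b := fun _ : ℝ ↦ x)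
    (s := fun s : ℝ ↦ σ (EuclideanSpace.single 0 s) x) (x₀ := t)).1 h0).2
  -- `h1`: `s ↦ Sᵀ (σ_s x) S` is smooth, `S = τ.symmL x` invertible with inverse `S'`
  have h2 : ContDiffAt ℝ ∞ (fun s : ℝ ↦ (ContinuousLinearMap.precomp ℝ (τ.symmL ℝ x)).comp
      ((σ (EuclideanSpace.single 0 s) x).comp (τ.symmL ℝ x))) t := contMDiffAt_iff_contDiffAt.1 h1
  set S : E3 →L[ℝ] E3 := (show E3 →L[ℝ] E3 from τ.symmL ℝ x) with hS
  set S' : E3 →L[ℝ] E3 :=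
    (show E3 →L[ℝ] E3 from (τ.continuousLinearEquivAt ℝ x hx).toContinuousLinearMap) with hS'
  have hSS' : ∀ v : E3, S (S' v) = v := by
    intro v
    show (τ.symmL ℝ x) ((τ.continuousLinearEquivAt ℝ x hx) v) = v
    rw [← Trivialization.symm_continuousLinearEquivAt_eq' τ hx]
    exact (τ.continuousLinearEquivAt ℝ x hx).symm_apply_apply v
  set Λ : (E3 →L[ℝ] E3 →L[ℝ] ℝ) →L[ℝ] (E3 →L[ℝ] E3 →L[ℝ] ℝ) :=
    (ContinuousLinearMap.compL ℝ E3 (E3 →L[ℝ] ℝ) (E3 →L[ℝ] ℝ) (ContinuousLinearMap.precomp ℝ S')).comp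
      ((ContinuousLinearMap.compL ℝ E3 E3 (E3 →L[ℝ] ℝ)).flip S') with hΛdef
  have hΛ : ∀ B : E3 →L[ℝ] E3 →L[ℝ] ℝ, Λ B = (ContinuousLinearMap.precomp ℝ S').comp (B.comp S') :=
    fun B ↦ rfl
  have h3 : ContDiffAt ℝ ∞ (fun s : ℝ ↦ Λ ((ContinuousLinearMap.precomp ℝ S).comp
      ((show E3 →L[ℝ] E3 →L[ℝ] ℝ from σ (EuclideanSpace.single 0 s) x).comp S))) t :=
    Λ.contDiff.contDiffAt.comp t h2
  have heq : (fun s : ℝ ↦ Λ ((ContinuousLinearMap.precomp ℝ S).comp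
      ((show E3 →L[ℝ] E3 →L[ℝ] ℝ from σ (EuclideanSpace.single 0 s) x).comp S))) =
      fun s : ℝ ↦ (show E3 →L[ℝ] E3 →L[ℝ] ℝ from σ (EuclideanSpace.single 0 s) x) := by
    funext s
    rw [hΛ]
    ext v w
    simp only [ContinuousLinearMap.comp_apply, ContinuousLinearMap.precomp_apply, hSS']
  rw [heq] at h3
  exact h3

/-- **The metric components of a smooth curve of data are `C^∞` in the parameter**:
`s ↦ h_{s e₀}(x)(u, w)` is `C^∞` for every `x`, `u`, `w`. [folklore] -/
theorem contDiff_h_inner_line {F : EuclideanSpace ℝ (Fin 1) → InitialDataSet (𝓡 3) X}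
    (hF : IsSmoothDataFamily 1 F) (x : X) (u w : TangentSpace (𝓡 3) x) :
    ContDiff ℝ ∞ (fun s : ℝ ↦ (F (EuclideanSpace.single 0 s)).h.inner x u w) := by
  have h := fun t ↦ contDiffAt_bilin_line (σ := fun c x ↦ (F c).h.inner x) hF.1 x t
  have hc : ContDiff ℝ ∞ (fun s : ℝ ↦
      (show E3 →L[ℝ] E3 →L[ℝ] ℝ from (F (EuclideanSpace.single 0 s)).h.inner x)) :=
    contDiff_iff_contDiffAt.2 h
  exact (hc.clm_apply contDiff_const).clm_apply contDiff_const

/-- **The `k` components of a smooth curve of data are `C^∞` in the parameter**: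
`s ↦ k_{s e₀}(x)(u, w)` is `C^∞` for every `x`, `u`, `w`. [folklore] -/
theorem contDiff_k_line {F : EuclideanSpace ℝ (Fin 1) → InitialDataSet (𝓡 3) X}
    (hF : IsSmoothDataFamily 1 F) (x : X) (u w : TangentSpace (𝓡 3) x) :
    ContDiff ℝ ∞ (fun s : ℝ ↦ (F (EuclideanSpace.single 0 s)).k x u w) := by
  have h := fun t ↦ contDiffAt_bilin_line (σ := fun c x ↦ (F c).k x) hF.2 x t
  have hc : ContDiff ℝ ∞ (fun s : ℝ ↦
      (show E3 →L[ℝ] E3 →L[ℝ] ℝ from (F (EuclideanSpace.single 0 s)).k x)) :=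
    contDiff_iff_contDiffAt.2 h
  exact (hc.clm_apply contDiff_const).clm_apply contDiff_const

/-! ### A smooth curve immersed at `0` is injective on a window -/

/-- `EuclideanSpace.single 0 (c 0) = c` in `ℝ¹`. [folklore] -/
theorem single_apply_zero_eq (c : EuclideanSpace ℝ (Fin 1)) :
    (EuclideanSpace.single 0 (c 0) : EuclideanSpace ℝ (Fin 1)) = c := by
  ext i
  have hi : i = 0 := Subsingleton.elim i 0
  subst hi
  simp

/-- **A scalar marker with non-zero derivative at `0` makes the curve injective on a window.** If
`μ` is any real-valued function of data such that `s ↦ μ (F (s e₀))` is `C¹` with non-zero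
derivative at `0` in the sense of the immersion condition
(`fderiv ℝ (fun c ↦ μ (F c)) 0 e₀ ≠ 0`), then `F` is injective on some window `‖c‖ < δ`.
[folklore] -/
theorem exists_window_injective_of_marker {F : EuclideanSpace ℝ (Fin 1) → InitialDataSet (𝓡 3) X}
    (μ : InitialDataSet (𝓡 3) X → ℝ)
    (hg : ContDiff ℝ 1 (fun s : ℝ ↦ μ (F (EuclideanSpace.single 0 s))))
    (h0 : fderiv ℝ (fun c ↦ μ (F c)) 0 (EuclideanSpace.single 0 (1 : ℝ)) ≠ 0) :
    ∃ δ > 0, ∀ c c' : EuclideanSpace ℝ (Fin 1), ‖c‖ < δ → ‖c'‖ < δ → F c = F c' → c = c' := by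
  set g : ℝ → ℝ := fun s ↦ μ (F (EuclideanSpace.single 0 s)) with hgdef
  -- `(fun c ↦ μ (F c)) = g ∘ (c ↦ c 0)`
  have hfac : (fun c : EuclideanSpace ℝ (Fin 1) ↦ μ (F c)) = g ∘ fun c ↦ c 0 := by
    funext c
    simp only [hgdef, Function.comp_apply, single_apply_zero_eq]
  -- the derivative of `g` at `0` is the immersion derivative
  have hproj : HasFDerivAt (𝕜 := ℝ) (fun c : EuclideanSpace ℝ (Fin 1) ↦ c 0)
      (PiLp.proj (𝕜 := ℝ) 2 (fun _ : Fin 1 ↦ ℝ) 0) 0 :=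
    PiLp.hasFDerivAt_apply 2 (0 : EuclideanSpace ℝ (Fin 1)) 0
  have hgd : HasDerivAt g (deriv g 0) ((fun c : EuclideanSpace ℝ (Fin 1) ↦ c 0) 0) := by
    have : ((fun c : EuclideanSpace ℝ (Fin 1) ↦ c 0) 0) = 0 := rfl
    rw [this]
    exact ((hg.differentiable one_ne_zero) 0).hasDerivAt
  have hcomp : HasFDerivAt (g ∘ fun c : EuclideanSpace ℝ (Fin 1) ↦ c 0)
      (deriv g 0 • PiLp.proj (𝕜 := ℝ) 2 (fun _ : Fin 1 ↦ ℝ) 0) 0 :=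
    hgd.comp_hasFDerivAt (0 : EuclideanSpace ℝ (Fin 1)) hproj
  have hd0 : deriv g 0 ≠ 0 := by
    intro hzero
    apply h0
    rw [hfac, hcomp.fderiv, hzero]
    simp
  obtain ⟨δ, hδ, hinj⟩ := exists_injOn_Ioo_of_deriv_ne_zero hg hd0
  refine ⟨δ, hδ, fun c c' hc hc' hF ↦ ?_⟩
  have hmem : ∀ d : EuclideanSpace ℝ (Fin 1), ‖d‖ < δ → d 0 ∈ Ioo (-δ) δ := fun d hd ↦ by
    have h1 : |d 0| ≤ ‖d‖ := by
      have := PiLp.norm_apply_le (p := 2) d 0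
      simpa using this
    exact abs_lt.1 (lt_of_le_of_lt h1 hd)
  have hgg : g (c 0) = g (c' 0) := by
    simp only [hgdef, single_apply_zero_eq, hF]
  have h00 : c 0 = c' 0 := hinj (hmem c hc) (hmem c' hc') hgg
  rw [← single_apply_zero_eq c, ← single_apply_zero_eq c', h00]

/-- **A smooth curve of data immersed at `0` is injective on a window**: for `F` jointly smooth
(`IsSmoothDataFamily 1 F`) and immersed at `0` (`IsImmersedAtZero 1 F`) there is `δ > 0` such that
`F` is injective on `‖c‖ < δ` (the immersion condition at `e₀` exhibits a scalar component
`h_c(x)(u, w)` or `k_c(x)(u, w)` with non-zero derivative at `0`; it is `C^∞` in `c`,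
`contDiff_h_inner_line` / `contDiff_k_line`, hence strictly monotone near `0`).
Christodoulou, CQG 16 (1999), p. A24. [folklore] -/
theorem exists_window_injective_of_isImmersedAtZero
    {F : EuclideanSpace ℝ (Fin 1) → InitialDataSet (𝓡 3) X}
    (hF : IsSmoothDataFamily 1 F) (himm : IsImmersedAtZero 1 F) :
    ∃ δ > 0, ∀ c c' : EuclideanSpace ℝ (Fin 1), ‖c‖ < δ → ‖c'‖ < δ → F c = F c' → c = c' := by
  have hv : (EuclideanSpace.single 0 (1 : ℝ) : EuclideanSpace ℝ (Fin 1)) ≠ 0 := by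
    intro h
    have := congrArg (fun v : EuclideanSpace ℝ (Fin 1) ↦ v 0) h
    simp at this
  obtain ⟨x, u, w, huw⟩ := himm _ hv
  rcases huw with hh | hk
  · exact exists_window_injective_of_marker (fun D ↦ D.h.inner x u w)
      ((contDiff_h_inner_line hF x u w).of_le (by exact_mod_cast le_top)) hh
  · exact exists_window_injective_of_marker (fun D ↦ D.k x u w)
      ((contDiff_k_line hF x u w).of_le (by exact_mod_cast le_top)) hk

/-! ### Window control suffices for curves -/

/-- **Window control suffices for curves immersed at the base point.** Let `F : ℝ¹ → InitialDataSet`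
be tame on the end `e` and immersed at `0`, and suppose that ON A WINDOW `‖c‖ < ε` its members lie in
`𝓓` and its members with `c ≠ 0` satisfy `P`. Then there is a curve `F'`, tame on `e`, with
`F' 0 = F 0`, injective, immersed at `0`, every member in `𝓓` and every member off `0` satisfying
`P` — `exists_tameFamily_of_localWindow` on the smaller window where `F` is moreover injective
(`exists_window_injective_of_isImmersedAtZero`). Christodoulou, CQG 16 (1999), p. A24. [folklore] -/
theorem exists_tameCurve_of_localWindow {e : AFEnd X} {𝓓 : Set (InitialDataSet (𝓡 3) X)}
    {P : InitialDataSet (𝓡 3) X → Prop} {F : EuclideanSpace ℝ (Fin 1) → InitialDataSet (𝓡 3) X}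
    (hF : IsTameDataFamily e 1 F) (himm : IsImmersedAtZero 1 F) {ε : ℝ} (hε : 0 < ε)
    (h𝓓 : ∀ c, ‖c‖ < ε → F c ∈ 𝓓) (hP : ∀ c, c ≠ 0 → ‖c‖ < ε → P (F c)) :
    ∃ F' : EuclideanSpace ℝ (Fin 1) → InitialDataSet (𝓡 3) X,
      IsTameDataFamily e 1 F' ∧ F' 0 = F 0 ∧ Injective F' ∧ IsImmersedAtZero 1 F' ∧
        (∀ c, F' c ∈ 𝓓) ∧ ∀ c ≠ 0, P (F' c) := by
  obtain ⟨δ, hδ, hinj⟩ := exists_window_injective_of_isImmersedAtZero hF.1 himm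
  have hε' : 0 < min ε δ := lt_min hε hδ
  exact exists_tameFamily_of_localWindow hF himm hε'
    (fun c c' hc hc' h ↦ hinj c c' (lt_of_lt_of_le hc (min_le_right _ _))
      (lt_of_lt_of_le hc' (min_le_right _ _)) h)
    (fun c hc ↦ h𝓓 c (lt_of_lt_of_le hc (min_le_left _ _)))
    fun c hc hcε ↦ hP c hc (lt_of_lt_of_le hcε (min_le_left _ _))

/-- **Window upgrade for curves** (no admissibility clause; the shape of the stub
`stub_windowUpgrade` of crux `CensorshipAlongKerrEnds`, route ExactKerrEnds, final-state summit): a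
tame curve immersed at `0` whose members with `0 < ‖c‖ < ε` satisfy `P` can be replaced by a tame,
injective, immersed curve through the same base datum on the same end all of whose members off `0`
satisfy `P`. Christodoulou, CQG 16 (1999), p. A24. [folklore] -/
theorem exists_tameCurve_of_window {e : AFEnd X} {P : InitialDataSet (𝓡 3) X → Prop}
    {F : EuclideanSpace ℝ (Fin 1) → InitialDataSet (𝓡 3) X}
    (hF : IsTameDataFamily e 1 F) (himm : IsImmersedAtZero 1 F)
    (hP : ∃ ε > (0 : ℝ), ∀ c, c ≠ 0 → ‖c‖ < ε → P (F c)) :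
    ∃ F' : EuclideanSpace ℝ (Fin 1) → InitialDataSet (𝓡 3) X,
      IsTameDataFamily e 1 F' ∧ F' 0 = F 0 ∧ Injective F' ∧ IsImmersedAtZero 1 F' ∧
        ∀ c ≠ 0, P (F' c) := by
  obtain ⟨ε, hε, hPε⟩ := hP
  obtain ⟨F', hF', h0, hinj, himm', -, hP'⟩ :=
    exists_tameCurve_of_localWindow (𝓓 := univ) hF himm hε (fun _ _ ↦ mem_univ _) hPε
  exact ⟨F', hF', h0, hinj, himm', hP'⟩

/-! ### The genericity forms for curves (no injectivity hypothesis) -/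

/-- **Tame codimension one from window-controlled CURVES, injectivity for free.** If through every
`d ∈ 𝓔` pass an end `e`, a window `ε > 0` and a one-parameter family `F`, tame on `e` and immersed at
`0`, with `F 0 = d`, whose members with `‖c‖ < ε` lie in `𝓓` and whose members with `0 < ‖c‖ < ε`
avoid `𝓔`, then `𝓔` has tame codimension at least `1` inside `𝓓` — the `m = 1` case of
`hasTameCodimAtLeastIn_of_localWindow` with the window-injectivity clause discharged by
`exists_window_injective_of_isImmersedAtZero` (through `exists_tameCurve_of_localWindow`). This is the
weakest witness form a curve construction has to deliver. Christodoulou, CQG 16 (1999), p. A24.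
[folklore] -/
theorem hasTameCodimAtLeastIn_one_of_localWindow {𝓓 𝓔 : Set (InitialDataSet (𝓡 3) X)}
    (h : ∀ d ∈ 𝓔, ∃ (e : AFEnd X) (ε : ℝ) (F : EuclideanSpace ℝ (Fin 1) → InitialDataSet (𝓡 3) X),
      0 < ε ∧ IsTameDataFamily e 1 F ∧ IsImmersedAtZero 1 F ∧ F 0 = d ∧
        (∀ c, ‖c‖ < ε → F c ∈ 𝓓) ∧ ∀ c, c ≠ 0 → ‖c‖ < ε → F c ∉ 𝓔) :
    HasTameCodimAtLeastIn 𝓓 𝓔 1 := by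
  intro d hd
  obtain ⟨e, ε, F, hε, hF, himm, h0, h𝓓, hE⟩ := h d hd
  obtain ⟨F', hF', hF'0, hinj', himm', h𝓓', hE'⟩ :=
    exists_tameCurve_of_localWindow (P := fun D ↦ D ∉ 𝓔) hF himm hε h𝓓 hE
  exact ⟨e, F', hF', himm', hF'0.trans h0, hinj', h𝓓', hE'⟩

/-- **Tame Christodoulou genericity (codimension one) from window-controlled CURVES, injectivity for
free**: `P` is tame-generic in `𝓓` with codimension `1` as soon as through every admissible datum
failing `P` pass an end `e`, a window `ε > 0` and a curve, tame on `e` and immersed at `0`, whose members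
with `‖c‖ < ε` are admissible and whose members with `0 < ‖c‖ < ε` satisfy `P`. Christodoulou, CQG 16
(1999), p. A24. [folklore] -/
theorem isTameChristodoulouGeneric_one_of_localWindow {𝓓 : Set (InitialDataSet (𝓡 3) X)}
    {P : InitialDataSet (𝓡 3) X → Prop}
    (h : ∀ d ∈ 𝓓, ¬ P d → ∃ (e : AFEnd X) (ε : ℝ) (F : EuclideanSpace ℝ (Fin 1) → InitialDataSet (𝓡 3) X),
      0 < ε ∧ IsTameDataFamily e 1 F ∧ IsImmersedAtZero 1 F ∧ F 0 = d ∧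
        (∀ c, ‖c‖ < ε → F c ∈ 𝓓) ∧ ∀ c, c ≠ 0 → ‖c‖ < ε → P (F c)) :
    IsTameChristodoulouGeneric 𝓓 P 1 := by
  refine hasTameCodimAtLeastIn_one_of_localWindow fun d hd ↦ ?_
  obtain ⟨e, ε, F, hε, hF, himm, h0, h𝓓, hP⟩ := h d hd.1 hd.2
  exact ⟨e, ε, F, hε, hF, himm, h0, h𝓓, fun c hc hcε hmem ↦ hmem.2 (hP c hc hcε)⟩

end InitialDataSet

end Literature.Geometry.Lorentzian

end
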